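import Literature.Computability.QuantumComplexity.QueryPrograms
import Summits.QuantumAdvantage.QuantumAdvantage.Theorems.SosSandwichHomogeneousPBAATExponent
import HarnessLib

/-!
# The one-query Deutsch–Jozsa "mean" algorithm in the tree's `QQueryAlg` model, and the exponent calibration of `AA_Q`

Support for route `SosSandwich` (crux `PseudoBoundedAA`, stmt-QuantumAdvantage-15237; the `Q_T` child line whose
crux is `AA_Q`, the Aaronson–Ambainis influence bound for QUANTUM acceptance probabilities — hypothesis of
`Theorems.SosSandwich.QueryRestrict.quantumQuerySimulable_of_aaQuery`):

* `meanAlg N` — the explicit ONE-query algorithm (workspace `Unit`, start `(0, false)`, both unitaries the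
  Householder reflection `QProg.householder` preparing the state `u(i,b) = (−1)^b/√(2N)`, accept `{start}`) with
  `meanAlg_acceptProb : acceptProb (meanAlg N) x = (Σ_k (−1)^{x_k})² / N²` — the Deutsch–Jozsa mean-square
  polynomial of lineage leafhand-3's `MeanSquare.exists_meanSquare` IS in `Q_1` (not only in `K_1`);
* `aaQuery_exponent_ge_two` — **any admissible `(c, C)` for `AA_Q` has `c ≥ 2`** (the `(ε/T)^1` law fails already
  for one-query algorithms: `Var = 2(N−1)/N³`, every `Inf = 16(N−1)/N⁴ = (8/N)·Var`), the `Q_T` analogue of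
  `pseudoBoundedAA_exponent_ge_two` / `homogeneousPBAAT_exponent_ge_two`.

Sources: DeutschJozsa1992 / CleveEkertMacchiavelloMosca1998 (the one-query mean amplitude); BealsEtAl2001 §2
(model); AaronsonAmbainis2014 Conj. 6 (exponent).
-/

noncomputable section

set_option linter.dupNamespace false

namespace Summit.QuantumAdvantage.QuantumAdvantage.Theorems.SosSandwich.MeanSquareAlg

open Matrix Finset Literature.Computability.Cryptography Literature.Computability.QuantumComplexity
open Literature.Computability.QuantumComplexity.QProg
open Literature.Probability.RandomGraphs.LowDegree (sgn)

variable {N : ℕ}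

/-- The prepared amplitudes `u(i,b) = (−1)^b / √(2N)`. [cite: BealsEtAl2001, §2] -/
def amp (N : ℕ) (s : Fin N × Bool × Unit) : ℝ := (if s.2.1 then -1 else 1) / Real.sqrt (2 * N)

/-- `u` is a unit vector (`N ≥ 1`). [folklore] -/
theorem sum_amp_sq (hN : 1 ≤ N) : ∑ s : Fin N × Bool × Unit, amp N s ^ 2 = 1 := by
  have hN' : (0 : ℝ) < 2 * N := by positivity
  have hsq : Real.sqrt (2 * N) ^ 2 = 2 * N := Real.sq_sqrt hN'.le
  have e : ∀ s : Fin N × Bool × Unit, amp N s ^ 2 = 1 / (2 * N) := fun s => by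
    unfold amp
    rw [div_pow, hsq]
    congr 1
    split_ifs <;> norm_num
  simp_rw [e]
  rw [Finset.sum_const, Finset.card_univ, Fintype.card_prod, Fintype.card_prod, Fintype.card_fin,
    Fintype.card_bool, Fintype.card_unit, nsmul_eq_mul]
  push_cast
  field_simp

/-- The start state `(0, false, ())`. [cite: BealsEtAl2001, §2] -/
def startS (hN : 1 ≤ N) : Fin N × Bool × Unit := (⟨0, hN⟩, false, ())

/-- **The one-query mean algorithm**: prepare `u`, query, un-prepare, accept iff back at the start state
(`reducible`, so that its workspace `Unit` and accept set unfold for rewriting). [cite: BealsEtAl2001, §2] -/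
@[reducible] def meanAlg (N : ℕ) (hN : 1 ≤ N) : QQueryAlg N where
  W := Unit
  queries := 1
  unitaries := fun _ => ⟨householder (amp N) (startS hN), householder_mem_unitaryGroup _ _⟩
  start := startS hN
  accept := {startS hN}

/-- One query. [folklore] -/
theorem meanAlg_queries (hN : 1 ≤ N) : (meanAlg N hN).queries = 1 := rfl

/-- The Householder matrix is symmetric (real entries). [folklore] -/
theorem householder_apply_comm {ι : Type*} [Fintype ι] [DecidableEq ι] (c : ι → ℝ) (k₀ : ι) (i j : ι) :
    householder c k₀ i j = householder c k₀ j i := by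
  have h := congrFun (congrFun (hhReal_transpose c k₀) j) i
  rw [transpose_apply] at h
  simp only [householder, map_apply, h]

/-- Row `start` of the preparation unitary is the prepared vector: `H_{start, t} = u(t)`. [folklore] -/
theorem householder_start_apply (hN : 1 ≤ N) (t : Fin N × Bool × Unit) :
    householder (amp N) (startS hN) (startS hN) t = (amp N t : ℂ) := by
  rw [householder_apply_comm]
  have h := congrFun (householder_mulVec_single (sum_amp_sq hN) (startS hN)) t
  rw [Matrix.mulVec_single_one] at h
  exact h

/-- The amplitude products along one oracle step: `u(i,b)·u(i, b ⊕ x_i) = (−1)^{x_i}/(2N)`. [folklore] -/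
theorem amp_mul_amp_xor (hN : 1 ≤ N) (x : Fin N → Bool) (i : Fin N) (b : Bool) :
    amp N (i, b, ()) * amp N (i, (b ^^ x i), ()) = sgn (x i) / (2 * N) := by
  have hN' : (0 : ℝ) ≤ 2 * N := by positivity
  unfold amp
  rw [div_mul_div_comm, Real.mul_self_sqrt hN']
  cases b <;> cases hx : x i <;> simp [sgn]

/-- The overlap `⟨u, O_x u⟩ = (1/N) Σ_k (−1)^{x_k}` (real form). [cite: BealsEtAl2001, §2] -/
theorem sum_amp_mul_amp_oracle (hN : 1 ≤ N) (x : Fin N → Bool) :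
    ∑ t : Fin N × Bool × Unit, amp N t * amp N (t.1, (t.2.1 ^^ x t.1), t.2.2) = (∑ k, sgn (x k)) / N := by
  rw [Fintype.sum_prod_type, Finset.sum_div]
  refine Finset.sum_congr rfl fun i _ => ?_
  rw [Fintype.sum_prod_type, Fintype.sum_bool, Fintype.sum_unique, Fintype.sum_unique]
  change amp N (i, true, ()) * amp N (i, (true ^^ x i), ()) + amp N (i, false, ()) * amp N (i, (false ^^ x i), ()) = _
  rw [amp_mul_amp_xor hN x i true, amp_mul_amp_xor hN x i false]
  have hNne : (N : ℝ) ≠ 0 := by exact_mod_cast (by omega : N ≠ 0)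
  field_simp
  ring

/-- **The acceptance probability of the mean algorithm is the mean-square polynomial**
`((1/N) Σ_k (−1)^{x_k})²`. [cite: BealsEtAl2001, §2] -/
theorem meanAlg_acceptProb (hN : 1 ≤ N) (x : Fin N → Bool) :
    (meanAlg N hN).acceptProb x = (∑ k, sgn (x k)) ^ 2 / (N : ℝ) ^ 2 := by
  classical
  -- the final state
  have hfin : (meanAlg N hN).finalState x =
      householder (amp N) (startS hN) *ᵥ (queryOracle x *ᵥ fun s => (amp N s : ℂ)) := by
    unfold QQueryAlg.finalState
    show Fin.foldl 1 (fun ψ _ => householder (amp N) (startS hN) *ᵥ (queryOracle x *ᵥ ψ))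
        (householder (amp N) (startS hN) *ᵥ Pi.single (startS hN) 1) = _
    rw [Fin.foldl_succ, Fin.foldl_zero, householder_mulVec_single (sum_amp_sq hN)]
  -- its `start` entry is the mean of the signs
  have hentry : (meanAlg N hN).finalState x (startS hN) = ((((∑ k, sgn (x k)) / N : ℝ)) : ℂ) := by
    rw [hfin, ← sum_amp_mul_amp_oracle hN x]
    change ∑ t, householder (amp N) (startS hN) (startS hN) t *
        (queryOracle x *ᵥ fun s => (amp N s : ℂ)) t = _
    simp only [householder_start_apply hN, queryOracle_mulVec_apply]
    push_cast
    rfl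
  unfold QQueryAlg.acceptProb
  rw [Finset.sum_filter, Finset.sum_eq_single (startS hN)]
  · have hmem : startS hN ∈ (meanAlg N hN).accept := Set.mem_singleton _
    rw [if_pos hmem, hentry, Complex.norm_real, Real.norm_eq_abs, sq_abs, div_pow]
  · intro s _ hs
    have hnot : s ∉ (meanAlg N hN).accept := fun h => hs (Set.mem_singleton_iff.mp h)
    rw [if_neg hnot]
  · intro h
    exact absurd (Finset.mem_univ _) h

/-- **Any admissible exponent of `AA_Q` is at least `2`.**  If `(c, C)` satisfies the Aaronson–Ambainis influence
bound for the acceptance probabilities of quantum query algorithms, then `c ≥ 2`: the one-query mean algorithm has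
`Var = 2(N−1)/N³` and every influence `16(N−1)/N⁴ = (8/N)·Var` (lineage leafhand-3's `MeanSquare.exists_meanSquare`),
so `c ∈ {0,1}` fails for `N > 8/C`.  The `Q_T` analogue of `pseudoBoundedAA_exponent_ge_two`.
[cite: AaronsonAmbainis2014, Conj. 6] -/
theorem aaQuery_exponent_ge_two (c : ℕ) {C : ℝ} (hC : 0 < C)
    (h : ∀ (N : ℕ) (Q : QQueryAlg N) (p : MvPolynomial (Fin N) ℝ) (ε : ℝ),
      1 ≤ Q.queries → (∀ x, evalBool p x = Q.acceptProb x) → 0 < ε → ε ≤ boolVariance p →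
        ∃ i : Fin N, C * (ε / Q.queries) ^ c ≤ influence i p) :
    2 ≤ c := by
  by_contra hc
  push Not at hc
  obtain ⟨n, hn⟩ := exists_nat_gt (8 / C)
  have hN : 1 ≤ n + 2 := by omega
  obtain ⟨p, -, hval, -, -, hInf, hVar⟩ := MeanSquare.exists_meanSquare (n + 2) hN
  have hN2 : (2 : ℝ) ≤ ((n + 2 : ℕ) : ℝ) := by exact_mod_cast (show 2 ≤ n + 2 by omega)
  set M : ℝ := ((n + 2 : ℕ) : ℝ) with hM
  have hM1 : 0 < M - 1 := by linarith
  have hMpos : 0 < M := by linarith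
  have hCM : 8 < C * M := by
    have h1 : 8 / C < M := hn.trans_le (by rw [hM]; exact_mod_cast Nat.le_add_right n 2)
    have := (div_lt_iff₀ hC).mp h1
    linarith [this]
  have hVpos : 0 < boolVariance p := by
    rw [hVar]; exact div_pos (mul_pos two_pos hM1) (pow_pos hMpos 3)
  have hpQ : ∀ x, evalBool p x = (meanAlg (n + 2) hN).acceptProb x := fun x => by
    rw [hval x, meanAlg_acceptProb hN x]
  obtain ⟨i, hi⟩ := h (n + 2) (meanAlg (n + 2) hN) p (boolVariance p) le_rfl hpQ hVpos le_rfl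
  rw [meanAlg_queries, Nat.cast_one, div_one, hVar, hInf] at hi
  have hv1 : 2 * (M - 1) / M ^ 3 ≤ 1 := by
    rw [div_le_one (pow_pos hMpos 3)]
    have hMM : 4 ≤ M * M := by nlinarith
    have h4 : 4 * M ≤ M ^ 3 := by
      rw [pow_succ, pow_two]; exact mul_le_mul_of_nonneg_right hMM hMpos.le
    linarith
  have hpow : 2 * (M - 1) / M ^ 3 ≤ (2 * (M - 1) / M ^ 3) ^ c := by
    interval_cases c
    · rw [pow_zero]; exact hv1
    · rw [pow_one]
  have hle : C * (2 * (M - 1) / M ^ 3) ≤ 16 * (M - 1) / M ^ 4 :=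
    (mul_le_mul_of_nonneg_left hpow hC.le).trans hi
  rw [← mul_div_assoc, div_le_div_iff₀ (pow_pos hMpos 3) (pow_pos hMpos 4)] at hle
  have e : C * (2 * (M - 1)) * M ^ 4 - 16 * (M - 1) * M ^ 3 = (2 * C * M - 16) * ((M - 1) * M ^ 3) := by
    ring
  have hprod : 0 < (2 * C * M - 16) * ((M - 1) * M ^ 3) :=
    mul_pos (by linarith) (mul_pos hM1 (pow_pos hMpos 3))
  linarith [hle, hprod, e]

end Summit.QuantumAdvantage.QuantumAdvantage.Theorems.SosSandwich.MeanSquareAlg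

end
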